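import Summits.HodgeConjecture.HodgeConjecture.Theorems.HodgeLocusCensusCubicRank4
import Summits.HodgeConjecture.HodgeConjecture.Theorems.HodgeLocusCensusCubicRank6
import Summits.HodgeConjecture.HodgeConjecture.Theorems.HodgeLocusCensusCubicRank8
import Summits.HodgeConjecture.HodgeConjecture.Theorems.HodgeLocusCensusCubicRank10
import Summits.HodgeConjecture.HodgeConjecture.Theorems.HodgeLocusCensusCubicCerts
import Summits.HodgeConjecture.HodgeConjecture.Theorems.HodgeLocusCensusCubicRows
import Summits.HodgeConjecture.HodgeConjecture.Theorems.HodgeLocusCensusTwoPlanes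
import Summits.HodgeConjecture.HodgeConjecture.Theorems.HodgeLocusCensusFiveTuple641
import Summits.HodgeConjecture.HodgeConjecture.Theorems.HodgeLocusCensusQuarticRowsPlaneSum
import HarnessLib

/-!
# HodgeLocusCensusCubicCells — the seven CUBIC census rank rows of `HodgeLocusCensusCubicRows` are theorems (cell pub-hlocus, LEAD gen 5, (T39))
HONEST FRAMING: certified instances and evidence bearing on the general Hodge conjecture; no claim.

Assembly file of the d = 3 plane-sum core: each `@[conjecture]`-tagged row `explainedSmooth_n_3_m_{sum,difference}` of `HodgeLocusCensusCubicRows`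
(rank of Movasati's matrix [p_{i+j}(δ)] on the Fermat cubic n-fold for δ = [P] ± [P_c], for EVERY field of characteristic 0 and every primitive
sixth root ζ) is proved by identifying its δ with a class list (`PlaneSum.planeList4 / cplaneList6/8/10` of `csumL` / `cdiffL`, using the landed
identities `TwoPlanes.standardP_eq/standardPc_eq`, `FiveTuple641.standardP6_eq/standardPc6_eq`, `PlaneSum.standardP8_eq/standardPc8_eq` and the
new ones below) and applying `ivhsRankEq3_of_cert_n` to the kernel-checked certificate and mode tables of `HodgeLocusCensusCubicCerts`.
Ranks: 7, 19, 38 ([P]+[P_c], n = 6, 8, 10) and 1, 6, 16, 32 ([P]−[P_c], n = 4, 6, 8, 10) — the numbers of record of the census (engine A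
`hlocus.LinearCycle` and the independent mod-p script), now kernel theorems.
-/

namespace Summit.HodgeConjecture.HodgeConjecture.HodgeLocus.Census.CubicSum

open TwistCells GrSection

/-! ## the schema planes of the cubic rows as head-twisted coordinate planes -/

/-- P_c of (6,3,0): twists (0,1,1,1). -/
theorem standardPc6_0_eq : standardPc 6 0 1 = plane64 0 1 1 1 := by
  unfold standardPc plane64
  congr 1
  funext e
  fin_cases e <;> rfl

/-- P_c of (8,3,1): twists (0,0,1,1,1). -/
theorem standardPc8_1_eq : standardPc 8 1 1 = plane84 0 0 1 1 1 := by
  unfold standardPc plane84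
  congr 1
  funext e
  fin_cases e <;> rfl

/-- P of the cubic tenfold rows: the untwisted coordinate 5-plane. -/
theorem standardP10_eq : standardP 10 = cplane10 0 0 0 := by
  unfold standardP cplane10
  congr 1
  funext e
  fin_cases e <;> rfl

/-- P_c of (10,3,2): twists (0,0,0,1,1,1). -/
theorem standardPc10_2_eq : standardPc 10 2 1 = cplane10 1 1 1 := by
  unfold standardPc cplane10
  congr 1
  funext e
  fin_cases e <;> rfl

/-- P_c of (10,3,3): twists (0,0,0,0,1,1). -/
theorem standardPc10_3_eq : standardPc 10 3 1 = cplane10 0 1 1 := by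
  unfold standardPc cplane10
  congr 1
  funext e
  fin_cases e <;> rfl

/-! ## [P] + [P_c] -/

/-- δ of (6,3,0)_sum is the class list of `csumL` on X³₆. -/
theorem csum_list6 : [(1, standardP 6), (1, standardPc 6 0 1)] = cplaneList6 csumL := by
  rw [FiveTuple641.standardP6_eq, standardPc6_0_eq]
  simp [cplaneList6, csumL]

/-- PROVED ROW: `explainedSmooth_6_3_0_sum` — rank [p_{i+j}(δ)] = 7. -/
theorem explainedSmooth_6_3_0_sum_holds : explainedSmooth_6_3_0_sum := by
  unfold explainedSmooth_6_3_0_sum ExplainedSmoothRow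
  rw [csum_list6]
  exact ivhsRankEq3_of_cert6 csumL csumCert csum_valid csumModeK6 csumOff6 csum_H1_6 csum_H2_6 csum_H3_6

/-- δ of (8,3,1)_sum is the class list of `csumL` on X³₈. -/
theorem csum_list8 : [(1, standardP 8), (1, standardPc 8 1 1)] = cplaneList8 csumL := by
  rw [PlaneSum.standardP8_eq, standardPc8_1_eq]
  simp [cplaneList8, csumL]

/-- PROVED ROW: `explainedSmooth_8_3_1_sum` — rank [p_{i+j}(δ)] = 19. -/
theorem explainedSmooth_8_3_1_sum_holds : explainedSmooth_8_3_1_sum := by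
  unfold explainedSmooth_8_3_1_sum ExplainedSmoothRow
  rw [csum_list8]
  exact ivhsRankEq3_of_cert8 csumL csumCert csum_valid csumModeK8 csumOff8 csum_H1_8 csum_H2_8 csum_H3_8

/-- δ of (10,3,2)_sum is the class list of `csumL` on X³₁₀. -/
theorem csum_list10 : [(1, standardP 10), (1, standardPc 10 2 1)] = cplaneList10 csumL := by
  rw [standardP10_eq, standardPc10_2_eq]
  simp [cplaneList10, csumL]

/-- PROVED ROW: `explainedSmooth_10_3_2_sum` — rank [p_{i+j}(δ)] = 38. -/
theorem explainedSmooth_10_3_2_sum_holds : explainedSmooth_10_3_2_sum := by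
  unfold explainedSmooth_10_3_2_sum ExplainedSmoothRow
  rw [csum_list10]
  exact ivhsRankEq3_of_cert10 csumL csumCert csum_valid csumModeK10 csumOff10 csum_H1_10 csum_H2_10 csum_H3_10

/-! ## [P] − [P_c] -/

/-- δ of (4,3,0)_difference is the class list of `cdiffL` on X³₄. -/
theorem cdiff_list4 : [(1, standardP 4), (-1, standardPc 4 0 1)] = PlaneSum.planeList4 cdiffL := by
  rw [TwoPlanes.standardP_eq, TwoPlanes.standardPc_eq]
  simp [PlaneSum.planeList4, cdiffL]

/-- PROVED ROW: `explainedSmooth_4_3_0_difference` — rank [p_{i+j}(δ)] = 1. -/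
theorem explainedSmooth_4_3_0_difference_holds : explainedSmooth_4_3_0_difference := by
  unfold explainedSmooth_4_3_0_difference ExplainedSmoothRow
  rw [cdiff_list4]
  exact ivhsRankEq3_of_cert4 cdiffL cdiffCert cdiff_valid cdiffModeK4 cdiffOff4 cdiff_H1_4 cdiff_H2_4 cdiff_H3_4

/-- δ of (6,3,1)_difference is the class list of `cdiffL` on X³₆. -/
theorem cdiff_list6 : [(1, standardP 6), (-1, standardPc 6 1 1)] = cplaneList6 cdiffL := by
  rw [FiveTuple641.standardP6_eq, FiveTuple641.standardPc6_eq]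
  simp [cplaneList6, cdiffL]

/-- PROVED ROW: `explainedSmooth_6_3_1_difference` — rank [p_{i+j}(δ)] = 6. -/
theorem explainedSmooth_6_3_1_difference_holds : explainedSmooth_6_3_1_difference := by
  unfold explainedSmooth_6_3_1_difference ExplainedSmoothRow
  rw [cdiff_list6]
  exact ivhsRankEq3_of_cert6 cdiffL cdiffCert cdiff_valid cdiffModeK6 cdiffOff6 cdiff_H1_6 cdiff_H2_6 cdiff_H3_6

/-- δ of (8,3,2)_difference is the class list of `cdiffL` on X³₈. -/
theorem cdiff_list8 : [(1, standardP 8), (-1, standardPc 8 2 1)] = cplaneList8 cdiffL := by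
  rw [PlaneSum.standardP8_eq, PlaneSum.standardPc8_eq]
  simp [cplaneList8, cdiffL]

/-- PROVED ROW: `explainedSmooth_8_3_2_difference` — rank [p_{i+j}(δ)] = 16. -/
theorem explainedSmooth_8_3_2_difference_holds : explainedSmooth_8_3_2_difference := by
  unfold explainedSmooth_8_3_2_difference ExplainedSmoothRow
  rw [cdiff_list8]
  exact ivhsRankEq3_of_cert8 cdiffL cdiffCert cdiff_valid cdiffModeK8 cdiffOff8 cdiff_H1_8 cdiff_H2_8 cdiff_H3_8

/-- δ of (10,3,3)_difference is the class list of `cdiffL` on X³₁₀. -/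
theorem cdiff_list10 : [(1, standardP 10), (-1, standardPc 10 3 1)] = cplaneList10 cdiffL := by
  rw [standardP10_eq, standardPc10_3_eq]
  simp [cplaneList10, cdiffL]

/-- PROVED ROW: `explainedSmooth_10_3_3_difference` — rank [p_{i+j}(δ)] = 32. -/
theorem explainedSmooth_10_3_3_difference_holds : explainedSmooth_10_3_3_difference := by
  unfold explainedSmooth_10_3_3_difference ExplainedSmoothRow
  rw [cdiff_list10]
  exact ivhsRankEq3_of_cert10 cdiffL cdiffCert cdiff_valid cdiffModeK10 cdiffOff10 cdiff_H1_10 cdiff_H2_10 cdiff_H3_10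

end Summit.HodgeConjecture.HodgeConjecture.HodgeLocus.Census.CubicSum
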